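import Literature.NumberTheory.GaloisRepresentations.LubinTateColemanRelativeSeriesTwo
import Literature.NumberTheory.GaloisRepresentations.LubinTateSubstChainValues
import HarnessLib

/-!
# The relative Coleman series of `β` IS `(G ∘ H₁) ∘ H₂` as soon as `φ^{-(m+1)}G` takes the value `β_m` at `H₁(H₂(ω_{m+1}))`
# (de Shalit I §2.2 uniqueness + II §4.9 (ii) «substitute `t = ω_n`», `q = 2`, unramified base — proofs only)

Topic `NumberTheory/GaloisRepresentations` (theorems only; no definition, no named fact, no instance).  Sequel of
`LubinTateColemanRelativeSeriesTwo` (`relColemanSeries`, `eq_relColemanSeries`) and `LubinTateSubstChainValues` (the generic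
evaluation chain).  In the lane's currency (`F` local, `q = 2`, `E ⊆ F^{nr}` finite Galois, `σ₀` an arithmetic Frobenius,
`β ∈ RelNormCoherentUnits hπ E`, `ω_{m+1} = cohPt hπ m`):

* `frobUnitBall_symm_comp_algebraMap`, `inclUnitBall_comp_algebraMap` — `φ⁻¹` fixes, and the inclusions `𝒪_E → 𝒪_{E·K_π^{m+1}}`
  respect, the coefficient ring `LTCoeff F` (the hypotheses `hσ`, `hι` of the chain lemmas);
* ★★ `relColemanSeries_eq_subst_subst_of_forall_evS` — **if `(ι φ^{-(m+1)} G)(H₁(H₂(ι ω_{m+1}))) = β_m` for all `m`, then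
  `g_β = (G ∘ H₁) ∘ H₂`** for `G ∈ 𝒪_E⟦X⟧`, `H₁, H₂ ∈ 𝒪_F⟦X⟧` without constant term; `relColemanSeries_eq_subst_of_forall_evS` (one
  substitution).  With `G = Q` the theta `t`-expansion, `H₁ = [1]_{P,f}` the Lubin–Tate isomorphism onto the curve's model and
  `H₂ = [a]_f` the Tate-module unit, this is de Shalit's «Thus `g_{e(𝔞)} = Q(T)`» (II §4.9) in the form the cell's CM bridge delivers it
  (memos `B6-BRIDGE-II-VALUES-w4g13.md` §3, `B6-BRIDGE-R1R2-TG-w4g14.md` §2).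

Cell `bsd-print-cf2`, width seat `bsd-line-cf2c-w4` g14; no summit statement is proved; BSD is not proved by any of this.

## References
* [deShalit1987] E. de Shalit, *Iwasawa theory of elliptic curves with complex multiplication* (1987), I §2.2 Theorem (uniqueness of
  `g_β`), II §4.5 (13), II §4.9 Proposition (ii).
* [Coleman1979] R. Coleman, *Division values in local fields*, Invent. Math. 53 (1979), Thm. A.
-/

noncomputable section

open Filter Topology
open scoped PowerSeries.WithPiTopology

namespace Literature.NumberTheory.GaloisRepresentations

section RelativeSubstChainTwo

open GaloisRepresentations.IsNonarchimedeanLocalField LubinTate ValuativeRel Field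

variable {F : Type} [Field F] [ValuativeRel F] [TopologicalSpace F] [IsNonarchimedeanLocalField F]

attribute [local instance] ltNormUniformSpace ltNormIsUniformAddGroup rk1 nF nE fintypeResidueField

variable {π : 𝒪[F]} (hπ : (valuation F).IsUniformizer (π : F))
variable (E : IntermediateField F (AlgebraicClosure F)) [FiniteDimensional F E]

/-- **`φ⁻¹` fixes the coefficients from `𝒪_F`**: `(frobUnitBall E σ₀)⁻¹ ∘ algebraMap = algebraMap` on `LTCoeff F`.
[cite: deShalit1987, Ch. I §1.1] -/
theorem frobUnitBall_symm_comp_algebraMap [Normal F E] (σ₀ : absoluteGaloisGroup F) :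
    ((frobUnitBall E σ₀).symm : unitBall E →+* unitBall E).comp (algebraMap (LTCoeff F) (unitBall E)) =
      algebraMap (LTCoeff F) (unitBall E) := by
  refine RingHom.ext fun a => ?_
  rw [RingHom.comp_apply]
  change (frobUnitBall E σ₀).symm (algebraMap (LTCoeff F) (unitBall E) a) = _
  rw [RingEquiv.symm_apply_eq]
  exact (unitBallEquiv_algebraMap E _ ((LTCoeff.of F).symm a)).symm

omit [FiniteDimensional F E] in
/-- **The inclusions of the tower respect the coefficients**: `inclUnitBall h ∘ algebraMap = algebraMap` on `LTCoeff F`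
(`inclUnitBall` is an algebra map over `LTCoeff F`). [cite: deShalit1987, Ch. I §1.8] -/
theorem inclUnitBall_comp_algebraMap {E₁ E₂ : IntermediateField F (AlgebraicClosure F)} [FiniteDimensional F E₁] [FiniteDimensional F E₂]
    (h : E₁ ≤ E₂) :
    (inclUnitBall (F := F) h : unitBall E₁ →+* unitBall E₂).comp (algebraMap (LTCoeff F) (unitBall E₁)) =
      algebraMap (LTCoeff F) (unitBall E₂) :=
  (inclUnitBall (F := F) h).comp_algebraMap

variable [Normal F E] [IsGalois F E] (hq : residueFieldCard F = 2) (hE : E ≤ maxUnramified F) {σ₀ : absoluteGaloisGroup F}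
  (hσ₀ : IsAbsArithFrob σ₀)

/-- ★★ **`g_β = (G ∘ H₁) ∘ H₂` from the values of `φ^{-(m+1)}G` at `H₁(H₂(ω_{m+1}))`.**  For `β ∈ 𝒰`, `G ∈ 𝒪_E⟦X⟧` and `H₁, H₂ ∈ 𝒪_F⟦X⟧`
without constant term: if for every `m` the value of `ι φ^{-(m+1)} G` at the point `H₁(H₂(ι ω_{m+1}))` of `𝔪_{E·K_π^{m+1}}` is `β_m`, then the
relative Coleman series of `β` is `(G ∘ H₁) ∘ H₂` (uniqueness `eq_relColemanSeries` + the evaluation chain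
`evS_map_iterate_map_subst_subst`: `φ⁻¹` and `ι` fix `𝒪_F`).  With `G = Q`, `H₁ = [1]_{P,f}`, `H₂ = [a]_f`: de Shalit II §4.9
«`g_{e(𝔞)} = Q`». [cite: deShalit1987, Ch. I §2.2 Theorem, II §4.9 Proposition (ii)] -/
theorem relColemanSeries_eq_subst_subst_of_forall_evS (β : RelNormCoherentUnits hπ E) (G : PowerSeries (unitBall E))
    {H₁ H₂ : PowerSeries (LTCoeff F)} (hH₁ : PowerSeries.constantCoeff H₁ = 0) (hH₂ : PowerSeries.constantCoeff H₂ = 0)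
    (hval : ∀ m, evS (maxNilIdeal F (E ⊔ ltField π m : IntermediateField F (AlgebraicClosure F)))
        (evalPt₁ (maxNilIdeal F (E ⊔ ltField π m : IntermediateField F (AlgebraicClosure F))) H₁ hH₁
          (evalPt₁ (maxNilIdeal F (E ⊔ ltField π m : IntermediateField F (AlgebraicClosure F))) H₂ hH₂
            (inclPt (le_sup_right : ltField π m ≤ E ⊔ ltField π m) (cohPt hπ m))))
        (PowerSeries.map (inclUnitBall (F := F) (le_sup_left : E ≤ E ⊔ ltField π m) :
          unitBall E →+* unitBall (E ⊔ ltField π m : IntermediateField F (AlgebraicClosure F)))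
          ((PowerSeries.map ((frobUnitBall E σ₀).symm : unitBall E →+* unitBall E))^[m + 1] G)) = β.val m) :
    relColemanSeries hπ E hq hE hσ₀ β =
      PowerSeries.subst (H₂.map (algebraMap (LTCoeff F) (unitBall E)))
        (PowerSeries.subst (H₁.map (algebraMap (LTCoeff F) (unitBall E))) G) := by
  symm
  refine eq_relColemanSeries hπ E hq hE hσ₀ fun m => ?_
  rw [evS_map_iterate_map_subst_subst (maxNilIdeal F (E ⊔ ltField π m : IntermediateField F (AlgebraicClosure F)))
    ((frobUnitBall E σ₀).symm : unitBall E →+* unitBall E) (frobUnitBall_symm_comp_algebraMap E σ₀)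
    (inclUnitBall (F := F) (le_sup_left : E ≤ E ⊔ ltField π m) : unitBall E →+* unitBall (E ⊔ ltField π m : IntermediateField F _))
    (inclUnitBall_comp_algebraMap le_sup_left) _ hH₁ hH₂ (m + 1) G]
  exact hval m

/-- **One substitution**: if `(ι φ^{-(m+1)} G)(H(ι ω_{m+1})) = β_m` for all `m`, then `g_β = G ∘ H`.
[cite: deShalit1987, Ch. I §2.2 Theorem, II §4.5 (iv)] -/
theorem relColemanSeries_eq_subst_of_forall_evS (β : RelNormCoherentUnits hπ E) (G : PowerSeries (unitBall E))
    {H : PowerSeries (LTCoeff F)} (hH : PowerSeries.constantCoeff H = 0)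
    (hval : ∀ m, evS (maxNilIdeal F (E ⊔ ltField π m : IntermediateField F (AlgebraicClosure F)))
        (evalPt₁ (maxNilIdeal F (E ⊔ ltField π m : IntermediateField F (AlgebraicClosure F))) H hH
          (inclPt (le_sup_right : ltField π m ≤ E ⊔ ltField π m) (cohPt hπ m)))
        (PowerSeries.map (inclUnitBall (F := F) (le_sup_left : E ≤ E ⊔ ltField π m) :
          unitBall E →+* unitBall (E ⊔ ltField π m : IntermediateField F (AlgebraicClosure F)))
          ((PowerSeries.map ((frobUnitBall E σ₀).symm : unitBall E →+* unitBall E))^[m + 1] G)) = β.val m) :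
    relColemanSeries hπ E hq hE hσ₀ β = PowerSeries.subst (H.map (algebraMap (LTCoeff F) (unitBall E))) G := by
  symm
  refine eq_relColemanSeries hπ E hq hE hσ₀ fun m => ?_
  rw [evS_map_iterate_map_subst (maxNilIdeal F (E ⊔ ltField π m : IntermediateField F (AlgebraicClosure F)))
    ((frobUnitBall E σ₀).symm : unitBall E →+* unitBall E) (frobUnitBall_symm_comp_algebraMap E σ₀)
    (inclUnitBall (F := F) (le_sup_left : E ≤ E ⊔ ltField π m) : unitBall E →+* unitBall (E ⊔ ltField π m : IntermediateField F _))
    (inclUnitBall_comp_algebraMap le_sup_left) _ hH (m + 1) G]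
  exact hval m

end RelativeSubstChainTwo

end Literature.NumberTheory.GaloisRepresentations

end
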